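import Literature.NumberTheory.EllipticCurves.OrdinaryFormalGroupLubinTate
import HarnessLib

/-!
# The Lubin–Tate `ℤ_p`-module structure of the formal group of an ordinary curve IS `[a] = exp_W(a·log_W)`:
# `[a]_{[π]} = [a]`, `[n]_{[π]} = formalMul n`, `log_W ∘ [a]_{[π]} = a·log_W` (de Shalit I §1.2, II §1.10; proofs only)

Topic `NumberTheory/EllipticCurves` (theorems only; no definition, no named fact, no instance).  Sequel of
`OrdinaryFormalGroupLubinTate.lean`: there, for a Weierstrass equation `V/ℤ_p` with elliptic fibres,
`a = p + 1 − #Ṽ(𝔽_p)` and a unit root `ϖ` of `T² − aT + p`, the integral series `[π] = exp_W(π log_W)`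
(`π = a − ϖ`, `W = V ⊗ ℚ_p`) is a Lubin–Tate series `f ∈ 𝔉_π` over `(ℤ_p, π, p)` and `V̂ = F_f`
(`formalGroupLaw_eq_ltF_of_root`).  Here we identify the Lubin–Tate endomorphisms `[a]_f = LubinTate.hom … a`
(Lubin–Tate 1965 (5): the unique `[a]_f ≡ aX` with `f ∘ [a]_f = [a]_f ∘ f`) with the curve's own `ℤ_p`-action:

* ★ `hom_eq_of_map_eq` — **`[a]_f = [a] := exp_W(a·log_W)`** for every `a ∈ ℤ_p` (both commute with `f = [π]`:
  `[π] ∘ [a] = [πa] = [a] ∘ [π]`, `FormalGroupPadicIntEndomorphisms.subst_of_map_eq`);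
* `hom_natCast_eq_formalMul` — `[n]_f = formalMul n` (so the `pⁿ`-division points of `F_f` are the formal
  `pⁿ`-torsion of `E`), `hom_neg_natCast_eq` — `[−n]_f = i ∘ formalMul n`;
* `formalLog_subst_map_hom` — **`log_W ∘ [a]_f = a·log_W`**: `log_W` is a logarithm of the Lubin–Tate group `F_f`
  normalised by `log_W′(0) = 1`, i.e. de Shalit's `λ_Ê` (II.4.9: «`λ_Ê` the logarithm of `Ê` normalized to
  `λ_Ê′(0) = 1`»; I.1.2).

Cell `bsd-print-cf2`, width seat `bsd-line-cf2c-w4` g12 (measure lane, brick B6 (i)); no summit statement is proved.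

## References
* [LubinTate1965] J. Lubin, J. Tate, Ann. of Math. 81 (1965), §1 (5), Thm. 1 (9)–(11).
* [deShalit1987] E. de Shalit, *Iwasawa theory of elliptic curves with complex multiplication* (1987), I §1.2,
  II §1.10, II §4.9 (`λ_Ê`).
* [SilvermanAEC2009] J. H. Silverman, *The Arithmetic of Elliptic Curves*, 2nd ed. (2009), IV.2.3, IV.5.5.
-/

noncomputable section

open scoped Classical
open PowerSeries Literature.NumberTheory.EllipticCurves Literature.NumberTheory.GaloisRepresentations.LubinTate

namespace WeierstrassCurve

variable {p : ℕ} [hp : Fact p.Prime] (V : WeierstrassCurve ℤ_[p]) [hE : (V.map PadicInt.Coe.ringHom).IsElliptic]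
  [hEt : (V.map PadicInt.toZMod).IsElliptic] {ϖ : ℤ_[p]} (hϖ : IsUnit ϖ)
  (hroot : ϖ ^ 2 - (Literature.NumberTheory.EllipticCurves.HasseManin.tr (V.map PadicInt.toZMod) : ℤ_[p]) * ϖ + p = 0)
  {P : ℤ_[p]⟦X⟧} (hP : P.map PadicInt.Coe.ringHom = (V.map PadicInt.Coe.ringHom).formalExp.subst
    (C (((Literature.NumberTheory.EllipticCurves.HasseManin.tr (V.map PadicInt.toZMod) : ℤ_[p]) - ϖ : ℤ_[p]) :
      ℚ_[p]) * (V.map PadicInt.Coe.ringHom).formalLog))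

/-- ★ **The Lubin–Tate endomorphism `[a]_f` of `F_f = V̂` (`f = [π]`) IS `[a] = exp_W(a·log_W)`**: for any integral
lift `Pa` of `[a]`, `LubinTate.hom _ f f a = Pa` — both are `≡ aX (mod deg 2)` and commute with `f`
(`[π] ∘ [a] = [πa] = [aπ] = [a] ∘ [π]`), so Lubin–Tate uniqueness applies. [cite: LubinTate1965, §1 (5)]
[cite: deShalit1987, Ch. I §1.2] -/
theorem hom_eq_of_map_eq {a : ℤ_[p]} {Pa : ℤ_[p]⟦X⟧} (hPa : Pa.map PadicInt.Coe.ringHom =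
      (V.map PadicInt.Coe.ringHom).formalExp.subst (C (a : ℚ_[p]) * (V.map PadicInt.Coe.ringHom).formalLog)) :
    hom (isLTRing_of_root (p := p) hϖ hroot) (V.isLTSeries_of_root hϖ hroot hP) (V.isLTSeries_of_root hϖ hroot hP) a
      = Pa := by
  symm
  set π : ℤ_[p] := (Literature.NumberTheory.EllipticCurves.HasseManin.tr (V.map PadicInt.toZMod) : ℤ_[p]) - ϖ with hπ
  obtain ⟨T, hT⟩ := V.exists_map_eq_formalExp_subst_C_mul_formalLog (π * a)
  have hT' : T.map PadicInt.Coe.ringHom = (V.map PadicInt.Coe.ringHom).formalExp.subst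
      (C ((a * π : ℤ_[p]) : ℚ_[p]) * (V.map PadicInt.Coe.ringHom).formalLog) := by
    rw [mul_comm a π]; exact hT
  refine eq_hom _ _ _ (constantCoeff_eq_zero_of_map_eq hPa) (coeff_one_eq_of_map_eq hPa) ?_
  -- `[π] ∘ [a] = [πa]` and `[a] ∘ [π] = [aπ]`
  rw [subst_of_map_eq hP hPa hT, subst_of_map_eq hPa hP hT']

/-- **`[n]_f = formalMul n`** (`n ∈ ℕ`): the Lubin–Tate multiplication by an integer on `F_f = V̂` is the curve's
formal multiplication-by-`n`; in particular the `pⁿ`-division points of `F_f` are the formal `pⁿ`-torsion of `E`.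
[cite: LubinTate1965, §1 Thm. 1] [cite: SilvermanAEC2009, IV.2.3] -/
theorem hom_natCast_eq_formalMul (n : ℕ) :
    hom (isLTRing_of_root (p := p) hϖ hroot) (V.isLTSeries_of_root hϖ hroot hP) (V.isLTSeries_of_root hϖ hroot hP)
      (n : ℤ_[p]) = V.formalMul n := by
  obtain ⟨Pn, hPn⟩ := V.exists_map_eq_formalExp_subst_C_mul_formalLog (n : ℤ_[p])
  rw [V.hom_eq_of_map_eq hϖ hroot hP hPn, eq_formalMul_of_map_eq hPn]

/-- `[−n]_f = i ∘ formalMul n` (`n ∈ ℕ`). [cite: LubinTate1965, §1 Thm. 1] [cite: SilvermanAEC2009, IV.2.3] -/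
theorem hom_neg_natCast_eq (n : ℕ) :
    hom (isLTRing_of_root (p := p) hϖ hroot) (V.isLTSeries_of_root hϖ hroot hP) (V.isLTSeries_of_root hϖ hroot hP)
      (-(n : ℤ_[p])) = V.formalNeg.subst (V.formalMul n) := by
  obtain ⟨Pn, hPn⟩ := V.exists_map_eq_formalExp_subst_C_mul_formalLog (-(n : ℤ_[p]))
  rw [V.hom_eq_of_map_eq hϖ hroot hP hPn, eq_formalNeg_subst_formalMul_of_map_eq hPn]

/-- `[π]_f = f = [π]` (the given lift), consistent with `LubinTate.hom_self_eq`. [cite: LubinTate1965, §1 Thm. 1 (11)] -/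
theorem hom_sub_eq :
    hom (isLTRing_of_root (p := p) hϖ hroot) (V.isLTSeries_of_root hϖ hroot hP) (V.isLTSeries_of_root hϖ hroot hP)
      ((Literature.NumberTheory.EllipticCurves.HasseManin.tr (V.map PadicInt.toZMod) : ℤ_[p]) - ϖ) = P :=
  hom_self_eq _ _

/-- ★ **`log_W ∘ [a]_f = a · log_W`**: the formal logarithm of `W = V ⊗ ℚ_p` is a logarithm of the Lubin–Tate group
`F_f = V̂` — it linearises every `[a]_f`, `a ∈ ℤ_p` — normalised by `log_W′(0) = 1`; i.e. de Shalit's `λ_Ê`.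
[cite: deShalit1987, Ch. I §1.2, Ch. II §4.9] [cite: SilvermanAEC2009, IV.5.5] -/
theorem formalLog_subst_map_hom (a : ℤ_[p]) :
    (V.map PadicInt.Coe.ringHom).formalLog.subst ((hom (isLTRing_of_root (p := p) hϖ hroot)
      (V.isLTSeries_of_root hϖ hroot hP) (V.isLTSeries_of_root hϖ hroot hP) a).map PadicInt.Coe.ringHom) =
      C (a : ℚ_[p]) * (V.map PadicInt.Coe.ringHom).formalLog := by
  obtain ⟨Pa, hPa⟩ := V.exists_map_eq_formalExp_subst_C_mul_formalLog a
  rw [V.hom_eq_of_map_eq hϖ hroot hP hPa, hPa]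
  exact (V.map PadicInt.Coe.ringHom).formalLog_subst_formalExp_subst_C_mul_formalLog _

/-- `log_W(F(z₁, z₂)) = log_W z₁ + log_W z₂` for the Lubin–Tate group `F_f = V̂` read over `ℚ_p` (the tree's
`formalLog_subst_formalGroupLaw` transported through `formalGroupLaw_eq_ltF_of_root`): together with
`formalLog_subst_map_hom`, `log_W` is THE normalised logarithm `λ` of the Lubin–Tate `ℤ_p`-module `F_f`.
[cite: deShalit1987, Ch. I §1.2] [cite: SilvermanAEC2009, IV.5.2] -/
theorem formalLog_subst_map_ltF :
    (V.map PadicInt.Coe.ringHom).formalLog.subst ((ltF (isLTRing_of_root (p := p) hϖ hroot)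
      (V.isLTSeries_of_root hϖ hroot hP)).map PadicInt.Coe.ringHom) =
      (V.map PadicInt.Coe.ringHom).formalLog.subst (MvPowerSeries.X 0 : MvPowerSeries (Fin 2) ℚ_[p]) +
        (V.map PadicInt.Coe.ringHom).formalLog.subst (MvPowerSeries.X 1 : MvPowerSeries (Fin 2) ℚ_[p]) := by
  rw [← V.formalGroupLaw_eq_ltF_of_root hϖ hroot hP, map_formalGroupLaw]
  exact (V.map PadicInt.Coe.ringHom).formalLog_subst_formalGroupLaw

end WeierstrassCurve
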